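import Summits.Ventures.HodgeRepro2.T5SU11ResolventKernelComposition
import Summits.Ventures.HodgeRepro2.T5SU11ResolventBoundaryEdge
import Summits.Ventures.HodgeRepro2.T5SU11GroundStateTransform
import Summits.Ventures.HodgeRepro2.T5SU11SphericalSymmetry

/-!
# The spherical functions are eigenfunctions of the resolvent: `(L − μ)⁻¹ φ_{λ′} = φ_{λ′}/(μ′ − μ)`

For `λ > 1` and `|λ′ − 1| < λ − 1` the spherical function `φ_{λ′}` lies in the exponentially decaying class of the
improper Green's operator `G^I_λ` (row 492): it is continuous, bounded on `(0, 1]` and decays like `e^{(λ′−2)t}` —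
for `1 < λ′ < λ` at the rate `2 − λ′ > 2 − λ` (row 447). Since `(L − μ) φ_{λ′} = (μ′ − μ) φ_{λ′}` and
`φ_{λ′}/φ_λ → 0` (row 466), the uniqueness theorem of row 497 gives

**`G^I_λ φ_{λ′} = φ_{λ′}/(μ′ − μ)` on `(0, ∞)`** (`greenSolI_sph_eq`; by the reflection `φ_{2−λ′} = φ_{λ′}` also for
`2 − λ < λ′ < 1`, `greenSolI_sph_eq'`), i.e. in kernel form (row 509)

**`∫_{(0,∞)} K_λ(t, s) φ_{λ′}(s) sinh 2s ds = φ_{λ′}(t)/(μ′ − μ)`** (`integral_kernel_mul_sph`)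

— the spherical transform of the Green's kernel row is the resolvent multiplier `1/(μ′ − μ)` (row 467's diagonalisation
read on the kernel). At the bottom of the spectrum, `λ′ = 1`, the ground state `Ξ = φ_1` decays only like `t e^{−t}`,
which is still inside the class for `λ > 1`: **`G^I_λ Ξ = −Ξ/(μ + 1)`** (`greenSolI_sph_one_eq`), the multiplier
`−1/(λ − 1)²` of row 481 recovered on the ground state itself. Nothing is claimed about (N).

Blind lane: Mathlib + the HodgeRepro2 prefix only; no sorry; axioms ⊆ {propext, Classical.choice,
Quot.sound}.
-/

namespace Summit.Ventures.HodgeRepro2.T5SU11ResolventEigenfunction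

open Filter Topology MeasureTheory
open Set (Ioi Ioc Icc)
open T5SU11Cartan T5SU11SphericalFunction T5SU11SphericalBounds T5SU11SphericalContinuous
  T5SU11SphericalSolutionSpaceAll T5SU11SphericalAsymptotic T5SU11SphericalCfun T5SU11SphericalDecay
  T5SU11SphericalSymmetry T5SU11ResolventBoundary T5SU11ResolventBoundaryEdge T5SU11ResolventDiagonalEdge
  T5SU11RadialGreenKernel T5SU11RadialGreenImproper T5SU11RadialGreenImproperOrigin
  T5SU11RadialGreenImproperDecaySource T5SU11RadialGreenImproperUnique T5SU11ResolventCommute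
  T5SU11ResolventKernelComposition T5SU11GroundStateTransform

section measure

variable [MeasurableSpace Circle] [BorelSpace Circle]

/-- `φ_{λ′}` is bounded on `(0, 1]` by its maximum on `[0, 1]`. -/
theorem exists_abs_sph_le_one (lam' : ℝ) : ∃ Φ : ℝ, 0 ≤ Φ ∧ ∀ s ∈ Ioc (0 : ℝ) 1, |sph lam' (hyp s)| ≤ Φ := by
  obtain ⟨Φ, hΦ0, hΦ⟩ := exists_sph_hyp_le lam'
  exact ⟨Φ, hΦ0.le, fun s hs => by
    rw [abs_of_pos (sph_hyp_pos lam' s)]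
    exact hΦ s ⟨hs.1.le, hs.2⟩⟩

/-- `φ_{λ′}` decays at the rate `2 − λ′` for `λ′ > 1`: `|φ_{λ′}(s)| ≤ 2c e^{−(2−λ′)s}` eventually. -/
theorem exists_abs_sph_le_exp {lam' : ℝ} (h1 : 1 < lam') :
    ∃ C s₀ : ℝ, ∀ s, s₀ ≤ s → |sph lam' (hyp s)| ≤ C * Real.exp (-(2 - lam') * s) := by
  obtain ⟨T₀, hT₀⟩ := eventually_atTop.mp (eventually_sph_hyp_le h1)
  refine ⟨2 * cfun (2 - lam'), T₀, fun s hs => ?_⟩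
  rw [abs_of_pos (sph_hyp_pos lam' s), show -(2 - lam') * s = (lam' - 2) * s by ring]
  exact hT₀ s hs

variable {lam lam' : ℝ} (hlam : 1 < lam) (h1 : 1 < lam') (h2 : lam' < lam)

include hlam h1 h2 in
/-- **`G^I_λ φ_{λ′} = φ_{λ′}/(μ′ − μ)` on `(0, ∞)`** for `1 < λ′ < λ`: the spherical function is an eigenfunction
of the resolvent with eigenvalue `1/(μ′ − μ)`. -/
theorem greenSolI_sph_eq {t : ℝ} (ht : 0 < t) :
    greenSolI (fun t => sph lam (hyp t)) (sphDecay lam) (fun s => sph lam' (hyp s)) t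
      = sph lam' (hyp t) / (lam' * (lam' - 2) - lam * (lam - 2)) := by
  have hκ : lam' * (lam' - 2) - lam * (lam - 2) ≠ 0 := (mu_sub_ne_zero h1 hlam).mpr (ne_of_lt h2)
  obtain ⟨Φ, hΦ0, hΦ⟩ := exists_abs_sph_le_one lam'
  obtain ⟨C, s₀, hC⟩ := exists_abs_sph_le_exp h1
  have hg : ContinuousOn (fun s => sph lam' (hyp s)) (Ioi 0) := (continuous_sph_hyp lam').continuousOn
  have hε : 2 - lam < 2 - lam' := by linarith
  -- the candidate `v = φ_{λ′}/(μ′ − μ)` and its derivative data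
  have hv : ∀ s, 0 < s → HasDerivAt (fun s => sph lam' (hyp s) / (lam' * (lam' - 2) - lam * (lam - 2)))
      (deriv (fun s => sph lam' (hyp s)) s / (lam' * (lam' - 2) - lam * (lam - 2))) s :=
    fun s hs => (hφ_sph lam' s hs).div_const _
  have hv' : ∀ s, 0 < s → HasDerivAt (fun s => deriv (fun s => sph lam' (hyp s)) s / (lam' * (lam' - 2) - lam * (lam - 2)))
      (deriv (deriv fun s => sph lam' (hyp s)) s / (lam' * (lam' - 2) - lam * (lam - 2))) s :=
    fun s hs => (hφ'_sph lam' s hs).div_const _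
  have hvode : ∀ s, 0 < s → Real.sinh (2 * s) * (deriv (deriv fun s => sph lam' (hyp s)) s
        / (lam' * (lam' - 2) - lam * (lam - 2)))
      + 2 * Real.cosh (2 * s) * (deriv (fun s => sph lam' (hyp s)) s / (lam' * (lam' - 2) - lam * (lam - 2)))
      = lam * (lam - 2) * Real.sinh (2 * s) * (sph lam' (hyp s) / (lam' * (lam' - 2) - lam * (lam - 2)))
        + Real.sinh (2 * s) * sph lam' (hyp s) := by
    intro s hs
    have e := hode_sph lam' s hs
    field_simp
    linear_combination e
  have hB : ∀ᶠ s in 𝓝[>] (0 : ℝ), |sph lam' (hyp s) / (lam' * (lam' - 2) - lam * (lam - 2))|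
      ≤ Φ / |lam' * (lam' - 2) - lam * (lam - 2)| := by
    filter_upwards [Ioc_mem_nhdsGT one_pos] with s hs
    rw [abs_div]
    exact div_le_div_of_nonneg_right (hΦ s hs) (abs_nonneg _)
  have hdecay : Tendsto (fun s => sph lam' (hyp s) / (lam' * (lam' - 2) - lam * (lam - 2)) / sph lam (hyp s)) atTop
      (𝓝 0) := by
    have := (tendsto_sph_hyp_div_atTop h1 h2).div_const (lam' * (lam' - 2) - lam * (lam - 2))
    rw [zero_div] at this
    refine this.congr (fun s => ?_)
    ring
  exact (eq_greenSolI_of_ode hlam hg hΦ hΦ0 hε hC hv hv' hvode hB hdecay ht).symm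

include hlam h1 h2 in
/-- **The spherical transform of the kernel row**: `∫_{(0,∞)} K_λ(t, s) φ_{λ′}(s) sinh 2s ds = φ_{λ′}(t)/(μ′ − μ)`
for `1 < λ′ < λ`. -/
theorem integral_kernel_mul_sph {t : ℝ} (ht : 0 < t) :
    ∫ s in Ioi 0, sphGreenKernel lam t s * sph lam' (hyp s) * Real.sinh (2 * s)
      = sph lam' (hyp t) / (lam' * (lam' - 2) - lam * (lam - 2)) := by
  obtain ⟨Φ, hΦ0, hΦ⟩ := exists_abs_sph_le_one lam'
  obtain ⟨C, s₀, hC⟩ := exists_abs_sph_le_exp h1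
  have hg : ContinuousOn (fun s => sph lam' (hyp s)) (Ioi 0) := (continuous_sph_hyp lam').continuousOn
  have hε : 2 - lam < 2 - lam' := by linarith
  have hB := integrableOn_sph_mul_mul_sinh_Ioc hg hΦ hΦ0 lam
  have hA := integrableOn_sphDecay_mul_mul_sinh hlam hg hΦ hΦ0 hε hC
  rw [← greenSolI_sph_eq hlam h1 h2 ht, greenSolI_eq_integral_kernel hB hA ht]
  rfl

include hlam in
/-- The reflected range: for `2 − λ < λ′ < 1`, `G^I_λ φ_{λ′} = φ_{λ′}/(μ′ − μ)` (`φ_{λ′} = φ_{2−λ′}`, row 428). -/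
theorem greenSolI_sph_eq' {lam' : ℝ} (h1 : 2 - lam < lam') (h2 : lam' < 1) {t : ℝ} (ht : 0 < t) :
    greenSolI (fun t => sph lam (hyp t)) (sphDecay lam) (fun s => sph lam' (hyp s)) t
      = sph lam' (hyp t) / (lam' * (lam' - 2) - lam * (lam - 2)) := by
  have h := greenSolI_sph_eq hlam (lam' := 2 - lam') (by linarith) (by linarith) ht
  have e : (fun s => sph (2 - lam') (hyp s)) = fun s => sph lam' (hyp s) := by
    funext s
    exact (sph_two_sub_hyp lam' s).symm
  rw [e] at h
  rw [h, ← sph_two_sub_hyp]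
  congr 1
  ring

/-! ### The ground state -/

/-- `Ξ = φ_1` decays at every rate `ε < 1`: `|Ξ(s)| ≤ C e^{−εs}` for `s ≥ 0`. -/
theorem exists_abs_sph_one_le_exp {ε : ℝ} (hε : ε < 1) :
    ∃ C : ℝ, ∀ s, (0 : ℝ) ≤ s → |sph 1 (hyp s)| ≤ C * Real.exp (-ε * s) := by
  obtain ⟨α, β, hα, hβ, hΞ⟩ := exists_exp_mul_sph_one_hyp_le
  set δ := 1 - ε with hδ
  have hδ0 : 0 < δ := by linarith
  refine ⟨α + β / δ, fun s hs => ?_⟩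
  have hE : 0 < Real.exp s := Real.exp_pos _
  rw [abs_of_pos (sph_hyp_pos 1 s)]
  have h1 : sph 1 (hyp s) ≤ (α + β * s) * Real.exp (-s) := by
    have := hΞ s hs
    rw [Real.exp_neg, ← div_eq_mul_inv, le_div_iff₀ hE, mul_comm]
    exact this
  have h2 : α + β * s ≤ (α + β / δ) * Real.exp (δ * s) := by
    have ha : (1 : ℝ) ≤ Real.exp (δ * s) := Real.one_le_exp (by positivity)
    have hb : s ≤ Real.exp (δ * s) / δ := le_exp_div hδ0
    calc α + β * s ≤ α * Real.exp (δ * s) + β * (Real.exp (δ * s) / δ) := by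
          apply add_le_add
          · nlinarith
          · exact mul_le_mul_of_nonneg_left hb hβ
      _ = (α + β / δ) * Real.exp (δ * s) := by ring
  calc sph 1 (hyp s) ≤ (α + β * s) * Real.exp (-s) := h1
    _ ≤ (α + β / δ) * Real.exp (δ * s) * Real.exp (-s) :=
        mul_le_mul_of_nonneg_right h2 (Real.exp_pos _).le
    _ = (α + β / δ) * Real.exp (-ε * s) := by
        rw [mul_assoc, ← Real.exp_add]; congr 2; rw [hδ]; ring

include hlam in
/-- **The resolvent of the ground state**: `G^I_λ Ξ = −Ξ/(μ + 1)` on `(0, ∞)` for every `λ > 1` — the multiplier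
`1/(μ₁ − μ) = −1/(λ − 1)²` of row 481 on `Ξ` itself. -/
theorem greenSolI_sph_one_eq {t : ℝ} (ht : 0 < t) :
    greenSolI (fun t => sph lam (hyp t)) (sphDecay lam) (fun s => sph 1 (hyp s)) t
      = -(sph 1 (hyp t) / (lam * (lam - 2) + 1)) := by
  have hκ : lam * (lam - 2) + 1 ≠ 0 := by nlinarith
  obtain ⟨Φ, hΦ0, hΦ⟩ := exists_abs_sph_le_one 1
  set ε := (3 - lam) / 2 with hε'
  have hε : 2 - lam < ε := by rw [hε']; linarith
  have hε1 : ε < 1 := by rw [hε']; linarith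
  obtain ⟨C, hC⟩ := exists_abs_sph_one_le_exp hε1
  have hC' : ∀ s, (0 : ℝ) ≤ s → |sph 1 (hyp s)| ≤ C * Real.exp (-ε * s) := hC
  have hg : ContinuousOn (fun s => sph 1 (hyp s)) (Ioi 0) := (continuous_sph_hyp 1).continuousOn
  have hv : ∀ s, 0 < s → HasDerivAt (fun s => -(sph 1 (hyp s) / (lam * (lam - 2) + 1)))
      (-(deriv (fun s => sph 1 (hyp s)) s / (lam * (lam - 2) + 1))) s :=
    fun s hs => ((hφ_sph 1 s hs).div_const _).neg
  have hv' : ∀ s, 0 < s → HasDerivAt (fun s => -(deriv (fun s => sph 1 (hyp s)) s / (lam * (lam - 2) + 1)))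
      (-(deriv (deriv fun s => sph 1 (hyp s)) s / (lam * (lam - 2) + 1))) s :=
    fun s hs => ((hφ'_sph 1 s hs).div_const _).neg
  have hvode : ∀ s, 0 < s → Real.sinh (2 * s) * (-(deriv (deriv fun s => sph 1 (hyp s)) s / (lam * (lam - 2) + 1)))
      + 2 * Real.cosh (2 * s) * (-(deriv (fun s => sph 1 (hyp s)) s / (lam * (lam - 2) + 1)))
      = lam * (lam - 2) * Real.sinh (2 * s) * (-(sph 1 (hyp s) / (lam * (lam - 2) + 1)))
        + Real.sinh (2 * s) * sph 1 (hyp s) := by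
    intro s hs
    have e := hode_sph 1 s hs
    field_simp
    linear_combination -e
  have hB : ∀ᶠ s in 𝓝[>] (0 : ℝ), |-(sph 1 (hyp s) / (lam * (lam - 2) + 1))| ≤ Φ / |lam * (lam - 2) + 1| := by
    filter_upwards [Ioc_mem_nhdsGT one_pos] with s hs
    rw [abs_neg, abs_div]
    exact div_le_div_of_nonneg_right (hΦ s hs) (abs_nonneg _)
  have hdecay : Tendsto (fun s => -(sph 1 (hyp s) / (lam * (lam - 2) + 1)) / sph lam (hyp s)) atTop (𝓝 0) := by
    have := ((tendsto_sph_one_hyp_div_atTop hlam).div_const (lam * (lam - 2) + 1)).neg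
    rw [zero_div, neg_zero] at this
    refine this.congr (fun s => ?_)
    ring
  exact (eq_greenSolI_of_ode hlam hg hΦ hΦ0 hε hC' hv hv' hvode hB hdecay ht).symm

end measure

end Summit.Ventures.HodgeRepro2.T5SU11ResolventEigenfunction
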